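import Summits.CriticalPhenomena.PercolationContinuityZ3.Theorems.Transplant.PlanarCellsNarrowSep
import HarnessLib

/-!
# TWO-UNIT planar cells `PCells2` (layer L1′ of route D″ v2, P4-GENERAL §16.2 (ii)), part 1: the boxes — one level count `K`, two stub
# increments `s₀, s₁`, units `r_i = K s_i`, every signed box with the RUN-axis unit along and the TRANSVERSE unit across; membership, containments

builds on p205010 (kernel theorem, internal audit signed; external expert review pending) — nothing in this file uses p205010.
Lane `prim-bschramm`, seat `prim-hp-8` (gen 27; D″ order of battle `HOME/bschramm/DPRIME-SCOPE.md` §2 L1′ + addenda B/B′, lead VERDICT V98,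
design-owner ruling R2: namespace `PCells2`, names as in `PCells`; the cell parameter is named `P` — the statement-dedup lint compares
printed statements WITHOUT binder types, so `(C : PCells2)` twins of `PCells` lemmas would read as restatements); helper file (`--supports stmt-CriticalPhenomena-4575 --as helper`).
Pure `Site 2`; the one-unit files `PlanarCells*` (node of record) are imported for their parameter-free lemmas (`PCells.mem_psBox_iff`,
`PCells.oneD_*`, `PCells.exists_adj_of_mem_Icc`, `PCells.sepInf_of_gap`, …) and are not edited.

WHY TWO UNITS (P4-GENERAL §16.1–16.2): with the axis-type point group `(ℤ/2)²` the certified single steps are band RECTANGLES `R(ℓ, G(ℓ))`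
(x-steps) and `R(F⁻¹(e), e)` (y-steps), so the renormalisation pattern is Kozma–Nitzan's scaled SEPARATELY in the two axes: `r_x = A e_x`,
`r_y = A e_y`.  Every cell fact below compares levels with levels (unit `r (δ.1)`) or transverse coordinates with transverse coordinates
(unit `r (oth δ.1)`), so the one-unit proofs port coordinatewise; the step-room conditions (X)(Y) of §16.2 are NOT cell facts (they enter the
chain-room lemmas of L6′ as hypotheses).
* `PCells2 := (K) (s : Fin 2 → ℕ) (hK : 20 ≤ K) (hs : ∀ i, 1 ≤ s i)`, `r i := K · s i`, `rmax := max (r 0) (r 1)`, `cen v i := 20 r_i v_i`,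
  half-width vectors `hw n := (n r₀, n r₁)`;
* anisotropic boxes `Q_v = cen v + [±5r₀]×[±5r₁]`, `M_v` (3), `Cell_v` (10); signed boxes along `δ = (a, σ)` with `r∥ := r a`, `r⊥ := r (oth a)`,
  `s∥ := s a`: `Btw (5r∥+1 … 15r∥−1; 5r⊥)`, `Efar (5r∥+1 … 25r∥; 5r⊥)`, `Ewv = Btw ∪ Q_{v+δ}`, `Stub j (5r∥ … 5r∥+10s∥j; 2r⊥)`,
  `Zone (10r∥ … 15r∥−10s∥; 2r⊥)`, `Face j`, `Hfull (5r∥ … 22r∥; 2r⊥)`; the NARROW boxes `BtwN/EfarN (…; 5r⊥−1)`, `EwvN`, `farAN`, the shrunk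
  far rows `farAS (5r∥+10s∥j+2 … 25r∥−1; 5r⊥−2)`; the level `lev δ v t = σ (t_a − cen v_a)`, the shifted face level `faceL a j`, `faceLo/faceHi`,
  the narrow probe world `probeWorldN v δ du = BtwN v δ ∪ Q x ∪ Hfull x du`;
* membership `mem_abox_iff`; `cen_gap/cen_congr/cen_add_stepVec_fst/oth/cen_zero/cen_cases`.
Parts 2–5 (`PlanarCells2Contain`, `PlanarCells2Sep`, `PlanarCells2Levels`, `PlanarCells2SepInf`): containments; disjointness and self-adjacency;
levels and planar bounds; every no-edge separation in ℓ^∞-gap-2 form with `hSQ / hSB / hSS` for the narrow probe world.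
[cite: KozmaNitzan2024, §4 pp. 25–26 (Q_v, M_v, E_{v,x}, H^j_{v,x}), p. 30 (F^j_{v,x}) — the ℤ^d model, one unit]
-/

noncomputable section

namespace Summit.CriticalPhenomena.PercolationContinuityZ3.Theorems

namespace Transplant

open Literature.Probability.Percolation Literature.Probability.LatticeModels SimpleGraph GadgetSystem Contour
open Literature.Probability.Percolation.KozmaNitzan
open Literature.Probability.Percolation.KozmaNitzan.Cells (oth oth_ne sgOf sgOf_sign stepVec_apply_fst stepVec_apply_oth eq_oth_of_ne oth_oth
  eq_of_coords)
open PCells (mem_psBox_iff)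

/-- **The parameters of the two-unit planar cells**: the number of stub levels `K ≥ 20` and one stub increment `s_i ≥ 1` PER AXIS; the
units are `r_i = K s_i` (one `K`, so that `10 r_i j / K = 10 s_i j` stays integral on both axes). [cite: KozmaNitzan2024, §4 pp. 25–26] -/
structure PCells2 where
  /-- the number of stub levels -/
  K : ℕ
  /-- the stub increments `r_i / K`, one per axis -/
  s : Fin 2 → ℕ
  /-- `K ≥ 20` -/
  hK : 20 ≤ K
  /-- `s_i ≥ 1` -/
  hs : ∀ i, 1 ≤ s i

namespace PCells2

variable (P : PCells2)

/-! ## Units and centres -/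

/-- The unit `r_i = K s_i` of axis `i`. [cite: KozmaNitzan2024, §4 p. 26] -/
def r (i : Fin 2) : ℕ := P.K * P.s i

/-- `1 ≤ r_i`. [folklore] -/
theorem one_le_r (i : Fin 2) : (1 : ℕ) ≤ P.r i := by
  have := P.hK; have := P.hs i; unfold r; nlinarith

/-- `20 s_i ≤ r_i`. [folklore] -/
theorem twenty_mul_s_le_r (i : Fin 2) : 20 * P.s i ≤ P.r i := by
  unfold r; exact Nat.mul_le_mul_right _ P.hK

/-- `r_i = K s_i` in `ℤ`. [folklore] -/
theorem r_eq (i : Fin 2) : (P.r i : ℤ) = P.K * P.s i := by simp [r]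

/-- `s_i j ≤ r_i` for `j ≤ K`. [folklore] -/
theorem s_mul_le_r {i : Fin 2} {j : ℕ} (hj : j ≤ P.K) : (P.s i : ℤ) * j ≤ P.r i := by
  have h := Nat.mul_le_mul_left (P.s i) hj
  rw [Nat.mul_comm (P.s i) P.K] at h
  exact_mod_cast (show P.s i * j ≤ P.r i from h)

/-- The larger unit `max (r₀, r₁)` (the ENVELOPE half-width: two-unit boxes inside one-unit squares). [folklore] -/
def rmax : ℕ := max (P.r 0) (P.r 1)

/-- `r_i ≤ rmax`. [folklore] -/
theorem r_le_rmax (i : Fin 2) : P.r i ≤ P.rmax := by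
  unfold rmax; fin_cases i
  · exact le_max_left _ _
  · exact le_max_right _ _

/-- The centre `(20 r₀ v₀, 20 r₁ v₁)` of the macro-vertex `v`. [cite: KozmaNitzan2024, §4 p. 26] -/
def cen (v : Site 2) : Site 2 := fun i => 20 * (P.r i : ℤ) * v i

/-- The centre, coordinatewise. [folklore] -/
@[simp] theorem cen_apply (v : Site 2) (i : Fin 2) : P.cen v i = 20 * (P.r i : ℤ) * v i := rfl

/-- `cen 0 = 0`. [folklore] -/
@[simp] theorem cen_zero : P.cen 0 = 0 := by funext i; simp

/-- Centres are monotone along a coordinate, with gaps of `20 r_i`. [folklore] -/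
theorem cen_gap {u v : Site 2} {i : Fin 2} (h : u i + 1 ≤ v i) : P.cen u i + 20 * (P.r i : ℤ) ≤ P.cen v i := by
  simp only [cen_apply]; nlinarith [P.one_le_r i]

/-- Equal coordinates give equal centre coordinates. [folklore] -/
theorem cen_congr {u v : Site 2} {i : Fin 2} (h : u i = v i) : P.cen u i = P.cen v i := by simp only [cen_apply, h]

/-- The centre of the macro-neighbour along the axis of the step. [folklore] -/
theorem cen_add_stepVec_fst (v : Site 2) (δ : MDir) : P.cen (v + stepVec δ) δ.1 = P.cen v δ.1 + sgOf δ * (20 * (P.r δ.1 : ℤ)) := by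
  simp only [cen_apply, Pi.add_apply, stepVec_apply_fst]; ring

/-- The centre of the macro-neighbour across the axis of the step. [folklore] -/
theorem cen_add_stepVec_oth (v : Site 2) (δ : MDir) : P.cen (v + stepVec δ) (oth δ.1) = P.cen v (oth δ.1) := by
  simp only [cen_apply, Pi.add_apply, stepVec_apply_oth, add_zero]

/-- Macro-coordinate comparison along axis `i`: the five cases with their centre relations (unit `r_i`). [folklore] -/
theorem cen_cases (u v : Site 2) (i : Fin 2) :
    (u i + 2 ≤ v i ∧ P.cen u i + 40 * (P.r i : ℤ) ≤ P.cen v i) ∨ (u i + 1 = v i ∧ P.cen u i + 20 * (P.r i : ℤ) = P.cen v i) ∨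
    (u i = v i ∧ P.cen u i = P.cen v i) ∨ (u i = v i + 1 ∧ P.cen u i = P.cen v i + 20 * (P.r i : ℤ)) ∨
    (v i + 2 ≤ u i ∧ P.cen v i + 40 * (P.r i : ℤ) ≤ P.cen u i) := by
  simp only [cen_apply]
  have hr : (0 : ℤ) ≤ P.r i := by positivity
  rcases lt_trichotomy (u i) (v i) with h | h | h
  · rcases eq_or_lt_of_le (show u i + 1 ≤ v i by omega) with h' | h'
    · exact Or.inr (Or.inl ⟨h', by rw [← h']; ring⟩)
    · exact Or.inl ⟨by omega, by nlinarith⟩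
  · exact Or.inr (Or.inr (Or.inl ⟨h, by rw [h]⟩))
  · rcases eq_or_lt_of_le (show v i + 1 ≤ u i by omega) with h' | h'
    · exact Or.inr (Or.inr (Or.inr (Or.inl ⟨h'.symm, by rw [← h']; ring⟩)))
    · exact Or.inr (Or.inr (Or.inr (Or.inr ⟨by omega, by nlinarith⟩)))

/-! ## The boxes -/

/-- The anisotropic half-width vector `(n r₀, n r₁)`. [folklore] -/
def hw (n : ℕ) : Site 2 := fun i => ((n * P.r i : ℕ) : ℤ)

/-- The half-width vector, coordinatewise. [folklore] -/
@[simp] theorem hw_apply (n : ℕ) (i : Fin 2) : P.hw n i = ((n * P.r i : ℕ) : ℤ) := rfl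

/-- `Q_v = cen v + [−5r₀, 5r₀] × [−5r₁, 5r₁]`. [cite: KozmaNitzan2024, §4 p. 26 (Q_v)] -/
def Q (v : Site 2) : Finset (Site 2) := Finset.Icc (P.cen v - P.hw 5) (P.cen v + P.hw 5)

/-- `M_v = cen v + [−3r₀, 3r₀] × [−3r₁, 3r₁]`. [cite: KozmaNitzan2024, §4 p. 26 (M_v)] -/
def M (v : Site 2) : Finset (Site 2) := Finset.Icc (P.cen v - P.hw 3) (P.cen v + P.hw 3)

/-- The cell `cen v + [−10r₀, 10r₀] × [−10r₁, 10r₁]`. [folklore] -/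
def Cell (v : Site 2) : Finset (Site 2) := Finset.Icc (P.cen v - P.hw 10) (P.cen v + P.hw 10)

/-- The between-box `cen v + {5r∥ < σ x_a < 15r∥} × [−5r⊥, 5r⊥]`. [cite: KozmaNitzan2024, §4 p. 26 (E_{v,x})] -/
def Btw (v : Site 2) (δ : MDir) : Finset (Site 2) :=
  sBox δ.1 (sgOf δ) (P.cen v) (5 * P.r δ.1 + 1) (15 * P.r δ.1 - 1) (5 * P.r (oth δ.1))

/-- `E^far_{v,x} = cen v + {5r∥ < σ x_a ≤ 25r∥} × [−5r⊥, 5r⊥]`. [cite: KozmaNitzan2024, §4 p. 26 (E_{v,x})] -/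
def Efar (v : Site 2) (δ : MDir) : Finset (Site 2) :=
  sBox δ.1 (sgOf δ) (P.cen v) (5 * P.r δ.1 + 1) (25 * P.r δ.1) (5 * P.r (oth δ.1))

/-- `E_{v,x} = Btw ∪ Q_x`. [cite: KozmaNitzan2024, §4 p. 26 (E_{v,x})] -/
def Ewv (v : Site 2) (δ : MDir) : Finset (Site 2) := P.Btw v δ ∪ P.Q (v + stepVec δ)

/-- The stub `H^j_{v,x} = cen v + {5r∥ ≤ σ x_a ≤ 5r∥ + 10 s∥ j} × [−2r⊥, 2r⊥]`. [cite: KozmaNitzan2024, §4 p. 26 (H^j_{v,x})] -/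
def Stub (v : Site 2) (δ : MDir) (j : ℕ) : Finset (Site 2) :=
  sBox δ.1 (sgOf δ) (P.cen v) (5 * P.r δ.1) (5 * P.r δ.1 + 10 * P.s δ.1 * j) (2 * P.r (oth δ.1))

/-- The stub zone `cen v + {10r∥ ≤ σ x_a ≤ 15r∥ − 10s∥} × [−2r⊥, 2r⊥]`. [cite: KozmaNitzan2024, §4 p. 26] -/
def Zone (v : Site 2) (δ : MDir) : Finset (Site 2) :=
  sBox δ.1 (sgOf δ) (P.cen v) (10 * P.r δ.1) (15 * P.r δ.1 - 10 * P.s δ.1) (2 * P.r (oth δ.1))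

/-- The face `F^j_{v,x} = cen v + {σ x_a = 5r∥ + 10s∥j} × [−2r⊥, 2r⊥]`. [cite: KozmaNitzan2024, §4 p. 30 (F^j_{v,x})] -/
def Face (v : Site 2) (δ : MDir) (j : ℕ) : Finset (Site 2) :=
  sBox δ.1 (sgOf δ) (P.cen v) (5 * P.r δ.1 + 10 * P.s δ.1 * j) (5 * P.r δ.1 + 10 * P.s δ.1 * j) (2 * P.r (oth δ.1))

/-- The full corridor `H_{v,x} = cen v + {5r∥ ≤ σ x_a ≤ 22r∥} × [−2r⊥, 2r⊥]`. [cite: KozmaNitzan2024, §4 p. 26 (H_{v,x})] -/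
def Hfull (v : Site 2) (δ : MDir) : Finset (Site 2) :=
  sBox δ.1 (sgOf δ) (P.cen v) (5 * P.r δ.1) (22 * P.r δ.1) (2 * P.r (oth δ.1))

/-- **The narrow between-box** `cen v + {5r∥ < σ x_a < 15r∥} × [−(5r⊥−1), 5r⊥−1]`. [cite: KozmaNitzan2024, §4 p. 26 (E_{v,x})] -/
def BtwN (v : Site 2) (δ : MDir) : Finset (Site 2) :=
  sBox δ.1 (sgOf δ) (P.cen v) (5 * P.r δ.1 + 1) (15 * P.r δ.1 - 1) (5 * P.r (oth δ.1) - 1)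

/-- **The narrow far region** `cen v + {5r∥ < σ x_a ≤ 25r∥} × [−(5r⊥−1), 5r⊥−1]`. [cite: KozmaNitzan2024, §4 p. 26 (E_{v,x})] -/
def EfarN (v : Site 2) (δ : MDir) : Finset (Site 2) :=
  sBox δ.1 (sgOf δ) (P.cen v) (5 * P.r δ.1 + 1) (25 * P.r δ.1) (5 * P.r (oth δ.1) - 1)

/-- **The narrow `E_{v,x} = BtwN ∪ Q_x`.** [cite: KozmaNitzan2024, §4 p. 26 (E_{v,x})] -/
def EwvN (v : Site 2) (δ : MDir) : Finset (Site 2) := P.BtwN v δ ∪ P.Q (v + stepVec δ)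

/-- **The narrow fresh rows above the stub of level `j`**: `cen x + {5r∥ + 10 s∥ j + 1 ≤ level ≤ 25 r∥} × [±(5r⊥−1)]`.
[cite: KozmaNitzan2024, §4 p. 30] -/
def farAN (x : Site 2) (du : MDir) (j : ℕ) : Finset (Site 2) :=
  sBox du.1 (sgOf du) (P.cen x) (5 * P.r du.1 + 10 * P.s du.1 * j + 1) (25 * P.r du.1) (5 * P.r (oth du.1) - 1)

/-- **The shrunk far rows** `cen x + {5r∥ + 10 s∥ j + 2 ≤ level ≤ 25 r∥ − 1} × [±(5r⊥−2)]` (one unit inside `farAN` on every side).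
[cite: KozmaNitzan2024, §4 p. 30 (the rows above H^j)] -/
def farAS (x : Site 2) (du : MDir) (j : ℕ) : Finset (Site 2) :=
  sBox du.1 (sgOf du) (P.cen x) (5 * P.r du.1 + 10 * P.s du.1 * j + 2) (25 * P.r du.1 - 1) (5 * P.r (oth du.1) - 2)

/-- The level of `t` along `δ` from `v`: `σ (t_a − cen v_a)`. [cite: KozmaNitzan2024, §4 p. 30] -/
def lev (δ : MDir) (v : Site 2) (t : Site 2) : ℤ := sgOf δ * (t δ.1 - P.cen v δ.1)

/-- **The planar level of the shifted face row `F^{j+1}` along axis `a`**: `5r_a + 10 s_a (j+1) − 1`. [cite: KozmaNitzan2024, §4 p. 30 (F^{j+1})] -/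
def faceL (a : Fin 2) (j : ℕ) : ℤ := 5 * (P.r a : ℤ) + 10 * (P.s a : ℤ) * ((j + 1 : ℕ) : ℤ) - 1

/-- Lower corner of the shifted face row (a degenerate signed box of transverse half-width `2r⊥`). [folklore] -/
def faceLo (x : Site 2) (du : MDir) (j : ℕ) : Site 2 := sLo du.1 (sgOf du) (P.cen x) (P.faceL du.1 j) (P.faceL du.1 j) (2 * P.r (oth du.1))

/-- Upper corner of the shifted face row. [folklore] -/
def faceHi (x : Site 2) (du : MDir) (j : ℕ) : Site 2 := sHi du.1 (sgOf du) (P.cen x) (P.faceL du.1 j) (P.faceL du.1 j) (2 * P.r (oth du.1))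

/-- **The narrow planar world of the probe `v → v+δ → v+δ+du`**: the narrow between-box, the target cube and its corridor.
[cite: KozmaNitzan2024, §4 p. 26 (E_{v,x}, H_{x,y})] -/
def probeWorldN (v : Site 2) (δ du : MDir) : Finset (Site 2) := P.BtwN v δ ∪ P.Q (v + stepVec δ) ∪ P.Hfull (v + stepVec δ) du

/-! ## Membership -/

/-- Membership in a centred anisotropic box of half-widths `(n r₀, n r₁)`. [folklore] -/
theorem mem_abox_iff {v : Site 2} {n : ℕ} {t : Site 2} :
    t ∈ Finset.Icc (P.cen v - P.hw n) (P.cen v + P.hw n) ↔ ∀ i, P.cen v i - (n * P.r i : ℕ) ≤ t i ∧ t i ≤ P.cen v i + (n * P.r i : ℕ) := by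
  rw [mem_Icc_iff]
  refine forall_congr' fun i => ?_
  simp only [Pi.sub_apply, Pi.add_apply, hw_apply]

/-- The shifted face row as a signed box. [folklore] -/
theorem Icc_faceLo_faceHi (x : Site 2) (du : MDir) (j : ℕ) :
    Finset.Icc (P.faceLo x du j) (P.faceHi x du j) = sBox du.1 (sgOf du) (P.cen x) (P.faceL du.1 j) (P.faceL du.1 j) (2 * P.r (oth du.1)) := rfl

end PCells2

end Transplant

end Summit.CriticalPhenomena.PercolationContinuityZ3.Theorems

end
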